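/-
Copyright (c) 2026. All rights reserved.
Released under Apache 2.0 license as described in the file LICENSE.
Authors: abc-iut cell, wave-4 seat abc-iut-w4-d059 (proof-only; T54-B, the tempered instantiation of the
(AI4″) producer: the VERTEX dictionary of the arithmetic decomposition groups at the standard level vertex).
-/
import Literature.AnabelianGeometry.SemiGraphs.SubgroupPresentationArithStabilizers
import Literature.AnabelianGeometry.SemiGraphs.ArithDecompositionData
import Literature.AnabelianGeometry.SemiGraphs.TemperedVerticialCommensurable
import HarnessLib

/-!
# [SemiAnbd] §5 p. 65 / Thm 5.4 (i) p. 66: the arithmetic vertex group `Π^temp_{𝔊,v}` IS the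
# `Φ`-normaliser of `Π^temp_{𝔾,v}`, and its dictionary with the standard level vertex (proof-only)

Mochizuki, *Semi-graphs of anabelioids*, Publ. RIMS **42** (2006), §5 p. 65 ("`Π^temp_{𝔊,v}` … may be
thought of as the commensurator in `Π^temp_𝔊` of `Π^temp_{𝔾,v}`"; Thm 3.7 (ii): verticial subgroups are
commensurably terminal) and Thm 5.4 (i) p. 66 [cite: MochizukiSemiAnbd2006, §5 p.65].

PROOF-ONLY file (abc-iut cell, sub-DAG `plan/L3/SUBDAG-SemiAnbd-Thm54.md`, producer row T54-B,
«T54·stabBranchPairAug-ASSEMBLY», seat abc-iut-w4-d059).  For a subgroup presentation `P` of `𝔾` in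
`π₁^temp(𝒢) = c.G` by verticial subgroups (`hPH`), an arithmetic group `E ⊇ ι(π₁^temp(𝒢))` acting
compatibly (`hP : P.IsArithCompatible Φ σ`) with the semi-direct product relation
`e · ι(x) · e⁻¹ = ι(Φ_e x)` (`hιconj`), and compatible representatives `Rc` MATCHED to the presentation at
the vertices (`hRcV : Rc.Hv = P.H`), the arithmetic decomposition group
`arithVertGp Rc ι v₀ = C_E(ι Π^temp_{𝔾,v₀})` of abc-iut-L3-t3's `decompositionDataOfChart` consists EXACTLY of
the `v ∈ E` with `σ_v v₀ = v₀` normalising `H_{v₀}` through `Φ` (vertex conjugator `1`):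
`sigma_fix_and_isVConj_one_of_mem_arithVertGp` (via Thm 3.7 (ii) rigidity
`eq_of_commensurable_of_mem_verticialSubgroups'` and self-normalisation) and
`mem_arithVertGp_of_isVConj_one`.  Consequences, the two VERTEX inputs of abc-iut-w4-d059's
`map_aug_le_conj_of_levelDict'` (`ArithBranchPairAug.lean`) at a coset level `N`:
`arithVertGp_fixes_vMk` (= `hωV`: the vertex group fixes the standard class `H_{v₀} · 1 · N`) and
`exists_mem_arithVertGp_of_fixes_vMk` (= `hωE`: an element fixing the standard class is in the vertex
group up to the level-`N` action kernel).  Also `exists_chartRepresentatives_of_presentation`: the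
representatives READ OFF the presentation (`Hv := H`, `Hb b := s_b M_{e(b)} s_b⁻¹`) exist.

No definition, no new named fact; nothing here takes a side on [IUTchIII] Cor. 3.12.
-/

namespace Literature.AnabelianGeometry.SemiGraphs

namespace ProfiniteSemiGraph

open CategoryTheory
open scoped Pointwise

universe u v

variable {𝒢 : ProfiniteSemiGraph.{u}} (c : TemperedPiChart 𝒢)
  (P : SemiGraph.SubgroupPresentation 𝒢.graph c.G)
  {E : Type v} [Group E] {Φ : E →* MulAut c.G} {σ : E →* Aut 𝒢.graph} (hP : P.IsArithCompatible Φ σ)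
  (ι : c.G →* E) (hι : Function.Injective ι)
  (hιconj : ∀ (e : E) (x : c.G), e * ι x * e⁻¹ = ι (Φ e x))
  (hPH : ∀ w, P.H w ∈ verticialSubgroups c w)
  (Rc : ChartRepresentatives c) (hRcV : ∀ v, Rc.Hv v = P.H v)

/-! ### Conjugating the image of a subgroup: the semi-direct product relation -/

omit [Group E] in
/-- Under the semi-direct product relation `e · ι(x) · e⁻¹ = ι(Φ_e x)`, conjugating `ι(H)` by `e` gives
`ι(Φ_e H)`. [cite: MochizukiSemiAnbd2006, §0 p.5] -/
theorem conjAct_smul_map_eq_map_map [Group E] {Φ : E →* MulAut c.G} (ι : c.G →* E)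
    (hιconj : ∀ (e : E) (x : c.G), e * ι x * e⁻¹ = ι (Φ e x)) (e : E) (H : Subgroup c.G) :
    ConjAct.toConjAct e • H.map ι = (H.map (Φ e).toMonoidHom).map ι := by
  ext y
  rw [Subgroup.mem_smul_pointwise_iff_exists]
  simp only [Subgroup.mem_map, MulEquiv.coe_toMonoidHom, ConjAct.smul_def, ConjAct.ofConjAct_toConjAct]
  constructor
  · rintro ⟨s, ⟨x, hx, rfl⟩, rfl⟩
    exact ⟨Φ e x, ⟨x, hx, rfl⟩, (hιconj e x).symm⟩
  · rintro ⟨_, ⟨x, hx, rfl⟩, rfl⟩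
    exact ⟨ι x, ⟨x, hx, rfl⟩, hιconj e x⟩

omit [Group E] in
/-- Commensurability pulls back along an injective homomorphism. [folklore] -/
private theorem commensurable_of_commensurable_map [Group E] (ι : c.G →* E) (hι : Function.Injective ι)
    {H K : Subgroup c.G} (h : Subgroup.Commensurable (H.map ι) (K.map ι)) :
    Subgroup.Commensurable H K := by
  obtain ⟨h1, h2⟩ := h
  rw [Subgroup.relIndex_map_map_of_injective _ _ hι] at h1 h2
  exact ⟨h1, h2⟩

/-! ### The arithmetic vertex group is the `Φ`-normaliser of `H_{v₀}` -/

include hP hι hιconj hPH hRcV in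
/-- **An element of `Π^temp_{𝔊,v₀} = C_E(ι Π^temp_{𝔾,v₀})` fixes `v₀` on the base and normalises `H_{v₀}`
through `Φ`** (vertex conjugator `1`): a vertex conjugator `k` gives `Φ_v(H_{v₀}) = k H_{σ_v v₀} k⁻¹`,
commensurable with `H_{v₀}` (semi-direct product relation, `ι` injective), so `σ_v v₀ = v₀` and
`k H_{v₀} k⁻¹ = H_{v₀}` by Thm 3.7 (ii) (`eq_of_commensurable_of_mem_verticialSubgroups'`), and `k ∈ H_{v₀}`
by self-normalisation. [cite: MochizukiSemiAnbd2006, §5 p.65] -/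
theorem sigma_fix_and_isVConj_one_of_mem_arithVertGp (h37 : 𝒢.Thm37Hypotheses)
    {v₀ : 𝒢.graph.Vertex} {v : E} (hv : v ∈ arithVertGp Rc ι v₀) :
    (σ v).hom.vertexMap v₀ = v₀ ∧ P.IsVConj Φ σ v v₀ 1 := by
  obtain ⟨k, hk⟩ := hP.exists_isVConj v v₀
  -- `Φ_v(H_{v₀}) = k H_{σ_v v₀} k⁻¹`
  have hmap : (P.H v₀).map (Φ v).toMonoidHom =
      (P.H ((σ v).hom.vertexMap v₀)).map (MulAut.conj k).toMonoidHom := by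
    ext y
    simp only [Subgroup.mem_map, MulEquiv.coe_toMonoidHom, MulAut.conj_apply]
    constructor
    · rintro ⟨x, hx, rfl⟩
      exact ⟨k⁻¹ * Φ v x * k, (hk x).mp hx, by group⟩
    · rintro ⟨z, hz, rfl⟩
      refine ⟨(Φ v)⁻¹ (k * z * k⁻¹), ?_, by simp⟩
      rw [hk, MulAut.apply_inv_self]
      simpa [mul_assoc] using hz
  -- commensurability in `E`, transported back to `π₁^temp`
  have hcomm : Subgroup.Commensurable (ConjAct.toConjAct v • (Rc.Hv v₀).map ι) ((Rc.Hv v₀).map ι) :=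
    (Subgroup.Commensurable.commensurator_mem_iff _ _).mp hv
  rw [hRcV, conjAct_smul_map_eq_map_map c ι hιconj, hmap] at hcomm
  have hcomm' := commensurable_of_commensurable_map c ι hι hcomm
  obtain ⟨hσ, hHk⟩ := eq_of_commensurable_of_mem_verticialSubgroups' h37 c
    (conj_mem_verticialSubgroups c (hPH _) k) (hPH v₀) hcomm'
  refine ⟨hσ, ?_⟩
  rw [hσ] at hHk
  -- `k ∈ H_{v₀}` by self-normalisation
  have hkH : k ∈ P.H v₀ := by
    refine hP.selfNormalizing v₀ k fun x => ?_
    constructor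
    · intro hx
      rw [← hHk] at hx
      obtain ⟨y, hy, hyx⟩ := hx
      rw [← hyx]
      simpa [mul_assoc] using hy
    · intro hx
      have : x ∈ (P.H v₀).map (MulAut.conj k).toMonoidHom := ⟨k⁻¹ * x * k, hx, by simp [mul_assoc]⟩
      rwa [hHk] at this
  intro x
  rw [hk x, hσ, inv_one, one_mul, mul_one]
  constructor
  · intro h
    have := (P.H v₀).mul_mem ((P.H v₀).mul_mem hkH h) ((P.H v₀).inv_mem hkH)
    simpa [mul_assoc] using this
  · intro h
    have := (P.H v₀).mul_mem ((P.H v₀).mul_mem ((P.H v₀).inv_mem hkH) h) hkH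
    simpa [mul_assoc] using this

include hιconj hRcV in
/-- **Conversely**: an element fixing `v₀` on the base and normalising `H_{v₀}` through `Φ` lies in
`Π^temp_{𝔊,v₀}` (it normalises `ι(H_{v₀})`). [cite: MochizukiSemiAnbd2006, §5 p.65] -/
theorem mem_arithVertGp_of_isVConj_one {v₀ : 𝒢.graph.Vertex} {v : E}
    (hσ : (σ v).hom.vertexMap v₀ = v₀) (hV : P.IsVConj Φ σ v v₀ 1) : v ∈ arithVertGp Rc ι v₀ := by
  have hmap : (P.H v₀).map (Φ v).toMonoidHom = P.H v₀ := by
    ext y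
    simp only [Subgroup.mem_map, MulEquiv.coe_toMonoidHom]
    constructor
    · rintro ⟨x, hx, rfl⟩
      have := (hV x).mp hx
      rwa [hσ, inv_one, one_mul, mul_one] at this
    · intro hy
      refine ⟨(Φ v)⁻¹ y, ?_, MulAut.apply_inv_self _ _ _⟩
      rw [hV, hσ, inv_one, one_mul, mul_one, MulAut.apply_inv_self]
      exact hy
  change v ∈ Subgroup.Commensurable.commensurator ((Rc.Hv v₀).map ι)
  rw [Subgroup.Commensurable.commensurator_mem_iff, hRcV, conjAct_smul_map_eq_map_map c ι hιconj, hmap]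

/-! ### The dictionary with the standard vertex class of a coset level -/

variable (N : Subgroup c.G) [N.Normal] (hN : ∀ (e : E) (x : c.G), x ∈ N → Φ e x ∈ N)
  (hιΦ : ∀ g : c.G, Φ (ι g) = MulAut.conj g) (hισ : ∀ g : c.G, σ (ι g) = 1)

include hι hιconj hPH hRcV hιΦ hισ in
/-- **`hωV`: the arithmetic vertex group fixes the standard vertex class** `H_{v₀} · 1 · N` of every
`Φ`-stable normal level `N`. [cite: MochizukiSemiAnbd2006, Thm 5.4 (i) p.66] -/
theorem arithVertGp_fixes_vMk (h37 : 𝒢.Thm37Hypotheses) {v₀ : 𝒢.graph.Vertex} {v : E}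
    (hv : v ∈ arithVertGp Rc ι v₀) :
    (P.arithAct hP N hN v).hom.vertexMap (P.vMk N v₀ 1) = P.vMk N v₀ 1 := by
  obtain ⟨hσ, hV⟩ := sigma_fix_and_isVConj_one_of_mem_arithVertGp c P hP ι hι hιconj hPH Rc hRcV h37 hv
  have := P.fixes_vMk_of_isVConj_one hP N hN ι hιΦ hισ v₀ v hσ hV 1 N.one_mem
  rwa [map_one, mul_one] at this

include hιconj hRcV hιΦ hισ in
/-- **`hωE`: an element fixing the standard vertex class lies in the arithmetic vertex group up to the
level kernel**: if `e` fixes `H_{v₀} · 1 · N` then `v⁻¹ e ∈ ker (arithAct N)` for some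
`v ∈ Π^temp_{𝔊,v₀}` (namely `v = e · ι(n)`, `n ∈ N`). [cite: MochizukiSemiAnbd2006, Thm 5.4 (i) p.66] -/
theorem exists_mem_arithVertGp_of_fixes_vMk {v₀ : 𝒢.graph.Vertex} (e : E)
    (hfix : (P.arithAct hP N hN e).hom.vertexMap (P.vMk N v₀ 1) = P.vMk N v₀ 1) :
    ∃ v ∈ arithVertGp Rc ι v₀, v⁻¹ * e ∈ (P.arithAct hP N hN).ker := by
  obtain ⟨hσ, n, hn, hV⟩ := P.exists_mul_inner_isVConj_one_of_fixes_vMk hP N hN ι hιΦ hισ v₀ e hfix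
  refine ⟨e * ι n, mem_arithVertGp_of_isVConj_one c P ι hιconj Rc hRcV ?_ hV, ?_⟩
  · rw [map_mul, SemiGraph.aut_mul_vertexMap, hισ]
    exact hσ
  · rw [MonoidHom.mem_ker, mul_inv_rev, mul_assoc, inv_mul_cancel, mul_one, ← map_inv]
    exact P.arithAct_eq_one_of_inner_mem hP N hN (hιΦ n⁻¹) (hισ n⁻¹) (N.inv_mem hn)

/-! ### The representatives read off a presentation -/

omit [Group E] in
include hPH in
/-- **Compatible representatives matched to the presentation exist**: `Hv := H`, `Hb b := s_b M_{e(b)} s_b⁻¹`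
(verticial by `hPH`, edge-like as a conjugate of the edge-like `M_e`, inside `H_w` by the presentation
axiom). [cite: MochizukiSemiAnbd2006, §5 p.65] -/
theorem exists_chartRepresentatives_of_presentation (hPM : ∀ e, P.M e ∈ edgeLikeSubgroups c e) :
    ∃ Rc : ChartRepresentatives c, (∀ v, Rc.Hv v = P.H v) ∧
      ∀ b, Rc.Hb b = (P.M (𝒢.graph.edgeOf b)).map (MulAut.conj (P.s b)).toMonoidHom :=
  ⟨⟨P.H, hPH, fun b => (P.M (𝒢.graph.edgeOf b)).map (MulAut.conj (P.s b)).toMonoidHom,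
    fun b => conj_mem_edgeLikeSubgroups' c (hPM _) _,
    fun b v hbv => by
      rintro _ ⟨m, hm, rfl⟩
      exact P.conj_mem b v hbv m hm⟩, fun _ => rfl, fun _ => rfl⟩

end ProfiniteSemiGraph

end Literature.AnabelianGeometry.SemiGraphs
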